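import Literature.MathematicalPhysics.QuantumFieldTheory.Balaban1983to89.B5G183FreeRowSum
import Literature.MathematicalPhysics.QuantumFieldTheory.Balaban1983to89.B5Hk163TorusHolderRate

/-!
# B5 (1.115), first entry «|GJ| ≤ O(1)|J|», as a CONCRETE `ℓ^∞ → ℓ^∞` bound for the torus matrix
# `G = Δ_1⁻¹` (a = 1, U = 1), uniform in `n = L^k` and in the torus

Source: T. Bałaban, *Propagators and renormalization transformations for lattice gauge theories. I*,
Commun. Math. Phys. **95** (1984) 17–40 (`Balaban1984PropagatorsI`, "B5"), Sect. F, pp. 35–36 [PDF 19–20];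
renders `b2b-balaban-ref1/pages/1984-cmp95-propagators-rt-I/…-p019-x2.png` (journal p. 35) and `…-p020-x2.png`
(journal p. 36) read as images this session.  A kernel-checked SUPPLEMENT to PUBLISHED work under line-by-line
audit by the pub-balaban cell; value = kernel certificate, NOT summit progress.

WHAT THE PAPER PRINTS (verbatim).  p. 30 (1.71): «Δ_a⁻¹ = G_k, or simply G» (typed in `B5DeltaA169`:
`DeltaA n M a = Δ − ∂*P∂ + a Q*Q`).  p. 35 (1.108): «|A| = max_μ sup_x |A_μ(x)|,»; «To describe decay properties
we use two families of cubes, both parametrized by points of the unit lattice T₁^{(k)}. Cubes Δ(y) are simply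
unit cubes of T_η, or Δ(y) = B^k(y), y ∈ T₁^{(k)}.»; Prop. 1.2: «There exists a positive constant δ₀ depending
on d only, such that |(GJ)(x)|, |(∇GJ)(x)|, |(G∇*J)(x)|, |(ΔGJ)(x)| ≤ O(1)e^{−δ₀|y−y′|}|J| (1.110) for
x ∈ Δ̃(y), supp J ⊂ Δ̃(y′), with the constant O(1) depending on d only,».  p. 36: «The localized inequalities
(1.110)–(1.114) imply immediately the following global inequalities
|GJ|, |∇GJ|, |G∇*J|, |ΔGJ|, ‖∇GJ‖_α, ‖G∇*J‖_α ≤ O(1)|J|, (1.115) … and (1.89), with the same dependence of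
the constants O(1).»; «A proof of Proposition 1.2 will be given in several steps. In the first step we will show
that the inequalities (1.115)–(1.117), (1.89) imply the proposition.»

CITATION HEADER (cell ABSOLUTE RULE).  Nothing of B5 is used as a hypothesis and no internally-minted
statement enters as a cited fact: every declaration below is kernel-proved from the tree ([folklore]); the page
references above are TEXT LOCATIONS of what is being supplemented, not sources of hypotheses.

WHAT IS TYPED HERE (zero sorry).  The printed word «immediately» for the FIRST entry of (1.115), carried out
CONCRETELY on the torus matrices of `B5Prop11Plancherel` / `B5DeltaA169` at `a = 1`, `U = 1`: for EVERY field
`J` on `T_η` (no support hypothesis) with `|J| ≤ B` and EVERY site `x` and direction `μ`,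

  `|(Δ_1⁻¹ J)_μ(x)| ≤ B · C(d, N)`,
  `C(d, N) = 2N·2^N·e^{1/(2(d+1))}·K_{d+1}(1/(2(d+1))) + (d+1)·MD183(d+1, N)·periodConst(κ₁₈₃(d+1), d)·K_{d+1}(κ₁₈₃(d+1)/(d+1))`

(`norm_DeltaA_one_inv_mulVec_le_global`; `K_D(a) = latticeConst D a = (2(1 − e^{−a/D})⁻¹)^D` of
`B4Sect5Proof`), every constant a function of `d` and of the free parameter `N ≥ d` only — UNIFORM in the
block size `n = L^k` and in the torus `T₁ = Π_μ ℤ/M_μ`.  ENGINE (three tree facts by name, plus bookkeeping):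
§1 the block decomposition `J = Σ_{y′ ∈ T₁} J·1_{B(y′)}` (`B5Blocks16.blockOf`, `bpt_bijective`) and linearity
`GJ = Σ_{y′} G(J·1_{B(y′)})` (`Matrix.mulVec_sum`); §2 the localized block bound of `B5G183FreeRowSum`
(`norm_DeltaA_one_inv_mulVec_le_uniform` = the first entry of (1.110) in operator form at `a = 1` with unit
cubes, `n`-free constants) applied to each piece, and the UNIFORM TORUS SUM
`Σ_{y′ ∈ T₁} e^{−a|y − y′|_{T₁,∞}} ≤ K_{d+1}(a)` (`B5Hk163TorusHolderRate.sum_exp_torusSupNorm_sub_rep_le`,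
itself `B4Sect5Torus.torusSum_le`), once per rate.

HONEST SCOPE.  (i) ONLY the first entry `|GJ|` of (1.115); not `|∇GJ|`, `|G∇*J|`, `|ΔGJ|`, not the Hölder
entries, not (1.116)–(1.117), not (1.89).  (ii) `a = 1` (convention of `B5G183Strip`), `U = 1`, finite torus,
`(d+1)`-dimensional index bookkeeping (`Fin (d+1)` directions); general `a` / `U ≠ 1` are open elsewhere.
(iii) Constants crude and ours; no printed `O(1)` is matched; the two rates of `B5G183FreeRowSum` are summed
separately (two lattice constants).  (iv) The abstract Setting-level edge `B5Global115.global_inst` /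
`global_of_prop12` ((1.110)–(1.114) ⇒ (1.115)–(1.117) over a `GlobCover` with smooth partitions `ζ′` and Hölder
pieces) is NOT instantiated here and nothing of it is restated: this file is the concrete sup-norm row of that
table for the actual matrix `Δ_1⁻¹`, with the indicator partition `1_{B(y′)}` (enough for sup norms) in place of
the smooth one.  (v) No `def`: the pieces `J·1_{B(y′)}` are written inline as `if blockOf x = y′ then J else 0`.
NEAREST TREE NEIGHBOURS (searched `lean search "DeltaA"`, `"mulVec_sum"`, `"latticeConst"` in `Balaban1983to89/**`):
`B5Global115` (abstract, see (iv)), `B5G183FreeRowSum` (localized, per block), `Beta/DeltaACombesThomas`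
(conditional, `ℓ²`).  Unit `b2b-balaban-pv15-g12` (PV15 cell lineage, generation 12).
-/

open scoped BigOperators Matrix ComplexConjugate Real
open Finset Complex Matrix

namespace Literature.MathematicalPhysics.QuantumFieldTheory.Balaban1983to89.B5G115SupBound

open Literature.MathematicalPhysics.QuantumFieldTheory.Balaban1983to89.B5Prop11Plancherel (Tor fine)
open Literature.MathematicalPhysics.QuantumFieldTheory.Balaban1983to89.B4TorusKernel (periodConst)
open Literature.MathematicalPhysics.QuantumFieldTheory.Balaban1983to89.B4TorusKernel.MultiPeriod (torusSupNorm)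
open Literature.MathematicalPhysics.QuantumFieldTheory.Balaban1983to89.B5Block118 (bpt)
open Literature.MathematicalPhysics.QuantumFieldTheory.Balaban1983to89.B5Blocks16 (bpt_bijective blockOf_bpt)
open Literature.MathematicalPhysics.QuantumFieldTheory.Balaban1983to89.B5DeltaA169 (DeltaA)
open Literature.MathematicalPhysics.QuantumFieldTheory.Balaban1983to89.B5G183Strip (kappa183 kappa183_pos)
open Literature.MathematicalPhysics.QuantumFieldTheory.Balaban1983to89.B5G183CovDecay (MD183 MD183_nonneg)
open Literature.MathematicalPhysics.QuantumFieldTheory.Balaban1983to89.B5Kernel166Decay (periodConst_pos)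
open Literature.MathematicalPhysics.QuantumFieldTheory.Balaban1983to89.B6LowerBound2153Torus (toT rep toT_rep)
open Literature.MathematicalPhysics.QuantumFieldTheory.Balaban1983to89.B4Sect5Proof (latticeConst latticeConst_nonneg)
open Literature.MathematicalPhysics.QuantumFieldTheory.Balaban1983to89.B5Hk163TorusHolderRate
  (sum_exp_torusSupNorm_sub_rep_le)
open Literature.MathematicalPhysics.QuantumFieldTheory.Balaban1983to89.B5G183FreeRowSum
  (norm_DeltaA_one_inv_mulVec_le_uniform)

noncomputable section

variable {d : ℕ}

/-! ## §1 Block pieces `J·1_{B(y′)}` and the linearity of `G` -/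

section Pieces

variable (n : ℕ) [NeZero n] (M : Fin (d + 1) → ℕ) [hM : ∀ μ, NeZero (M μ)]

/-- every fine site is a block point of its own block: `x = n·blockOf(x) + r` for some offset `r`
(B5 (1.6), `B5Blocks16.bpt_bijective`). [folklore] -/
theorem exists_eq_bpt_blockOf (t : Tor (fine n M)) :
    ∃ r : Fin (d + 1) → Fin n, t = bpt n M (B5Blocks16.blockOf n M t) r := by
  obtain ⟨⟨y, r⟩, h⟩ := (bpt_bijective n M).2 t
  refine ⟨r, ?_⟩
  simp only at h
  rw [← h, blockOf_bpt]

/-- the block decomposition of a field, pointwise: `J(x) = Σ_{y′ ∈ T₁} (J·1_{B(y′)})(x)`. [folklore] -/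
theorem sum_piece_eq (J : Tor (fine n M) × Fin (d + 1) → ℂ) (j : Tor (fine n M) × Fin (d + 1)) :
    ∑ y' : Tor M, (if B5Blocks16.blockOf n M j.1 = y' then J j else 0) = J j := by
  rw [Finset.sum_ite_eq]
  simp

/-- linearity of a matrix over the block decomposition: `AJ = Σ_{y′ ∈ T₁} A(J·1_{B(y′)})`. [folklore] -/
theorem mulVec_eq_sum_pieces
    (A : Matrix (Tor (fine n M) × Fin (d + 1)) (Tor (fine n M) × Fin (d + 1)) ℂ)
    (J : Tor (fine n M) × Fin (d + 1) → ℂ) :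
    A *ᵥ J = ∑ y' : Tor M, A *ᵥ (fun j => if B5Blocks16.blockOf n M j.1 = y' then J j else 0) := by
  rw [← Matrix.mulVec_sum]
  congr 1
  funext j
  rw [Finset.sum_apply]
  exact (sum_piece_eq n M J j).symm

/-- the piece `J·1_{B(y′)}` is supported in the block `B(y′)`, in the `toT ∘ rep` coordinates used by
`B5G183FreeRowSum`. [folklore] -/
theorem piece_supp (J : Tor (fine n M) × Fin (d + 1) → ℂ) (y' : Tor M) (j : Tor (fine n M) × Fin (d + 1))
    (h : (if B5Blocks16.blockOf n M j.1 = y' then J j else 0) ≠ 0) :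
    ∃ r' : Fin (d + 1) → Fin n, j.1 = bpt n M (toT M (rep M y')) r' := by
  by_cases hb : B5Blocks16.blockOf n M j.1 = y'
  · obtain ⟨r', hr'⟩ := exists_eq_bpt_blockOf n M j.1
    refine ⟨r', ?_⟩
    rw [toT_rep, ← hb]
    exact hr'
  · exact absurd (by simp [hb]) h

/-- the piece is bounded by the sup norm of `J` ((1.108)). [folklore] -/
theorem norm_piece_le (J : Tor (fine n M) × Fin (d + 1) → ℂ) {B : ℝ} (hJB : ∀ j, ‖J j‖ ≤ B) (y' : Tor M)
    (j : Tor (fine n M) × Fin (d + 1)) :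
    ‖(if B5Blocks16.blockOf n M j.1 = y' then J j else 0 : ℂ)‖ ≤ B := by
  split_ifs
  · exact hJB j
  · simpa using (norm_nonneg _).trans (hJB j)

end Pieces

/-! ## §2 The global sup-norm bound: (1.115), first entry, for `G = Δ_1⁻¹` -/

section Main

variable (n : ℕ) [NeZero n] (hn : 1 ≤ n) (M : Fin (d + 1) → ℕ) [hM : ∀ μ, NeZero (M μ)]

include hn in
/-- **(1.115), first entry, at block points**: for every field `J` on `T_η` with `|J| ≤ B` (sup norm (1.108)),
every unit-lattice point `y ∈ T₁`, offset `r` and direction `μ`,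
`|(Δ_1⁻¹ J)_μ(n·y + r)| ≤ B·(C_free·K_{d+1}(1/(2(d+1))) + (d+1)·C_cov·K_{d+1}(κ₁₈₃(d+1)/(d+1)))` with
`C_free = 2N·2^N·e^{1/(2(d+1))}`, `C_cov = MD183(d+1,N)·periodConst(κ₁₈₃(d+1),d)` — the block decomposition of
`J`, the localized bound `B5G183FreeRowSum.norm_DeltaA_one_inv_mulVec_le_uniform` per block, and the uniform torus
sum `B5Hk163TorusHolderRate.sum_exp_torusSupNorm_sub_rep_le` once per rate.  Constants depend on `d`, `N` only.
(Location of the printed text: `Balaban1984PropagatorsI` p. 36, (1.115); the typed inequality and its constants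
are ours, not a quotation.) [folklore] -/
theorem norm_DeltaA_one_inv_mulVec_bpt_le_global {Nn : ℕ} (hN : d + 1 ≤ Nn + 1)
    (J : Tor (fine n M) × Fin (d + 1) → ℂ) {B : ℝ} (hJB : ∀ j, ‖J j‖ ≤ B)
    (y : Tor M) (r : Fin (d + 1) → Fin n) (μ : Fin (d + 1)) :
    ‖((DeltaA n M 1)⁻¹ *ᵥ J) (bpt n M y r, μ)‖
      ≤ B * (2 * Nn * 2 ^ Nn * Real.exp (1 / (2 * (d + 1))) * latticeConst (d + 1) (1 / (2 * (d + 1)))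
          + (d + 1) * (MD183 (d + 1) Nn * periodConst (kappa183 (d + 1)) d
              * latticeConst (d + 1) (kappa183 (d + 1) / (d + 1)))) := by
  have hδ₁ : (0 : ℝ) < 1 / (2 * (d + 1)) := by positivity
  have hδ₂ : (0 : ℝ) < kappa183 (d + 1) / (d + 1) := div_pos (kappa183_pos _) (by positivity)
  have hB : 0 ≤ B := (norm_nonneg _).trans (hJB (bpt n M y r, μ))
  have hC₁ : (0 : ℝ) ≤ 2 * Nn * 2 ^ Nn * Real.exp (1 / (2 * (d + 1))) := by positivity
  have hC₂ : (0 : ℝ) ≤ MD183 (d + 1) Nn * periodConst (kappa183 (d + 1)) d :=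
    mul_nonneg (MD183_nonneg _ _) (periodConst_pos (kappa183_pos _) _).le
  have hd : (0 : ℝ) ≤ d + 1 := by positivity
  -- the localized bound, block by block
  have hblock : ∀ y' : Tor M,
      ‖((DeltaA n M 1)⁻¹ *ᵥ fun j => if B5Blocks16.blockOf n M j.1 = y' then J j else 0) (bpt n M y r, μ)‖
        ≤ B * (2 * Nn * 2 ^ Nn * Real.exp (1 / (2 * (d + 1)))
                * Real.exp (-(1 / (2 * (d + 1)) * torusSupNorm M (rep M y - rep M y')))
            + (d + 1) * (MD183 (d + 1) Nn * periodConst (kappa183 (d + 1)) d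
                * Real.exp (-(kappa183 (d + 1) / (d + 1) * torusSupNorm M (rep M y - rep M y'))))) := by
    intro y'
    have h := norm_DeltaA_one_inv_mulVec_le_uniform n hn M hN (rep M y) (rep M y')
      (fun j => if B5Blocks16.blockOf n M j.1 = y' then J j else 0) (norm_piece_le n M J hJB y')
      (piece_supp n M J y') r μ
    rwa [toT_rep] at h
  -- the two uniform torus sums
  have hS₁ : ∑ y' : Tor M, Real.exp (-(1 / (2 * (d + 1)) * torusSupNorm M (rep M y - rep M y')))
      ≤ latticeConst (d + 1) (1 / (2 * (d + 1))) :=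
    sum_exp_torusSupNorm_sub_rep_le M hδ₁ (rep M y)
  have hS₂ : ∑ y' : Tor M, Real.exp (-(kappa183 (d + 1) / (d + 1) * torusSupNorm M (rep M y - rep M y')))
      ≤ latticeConst (d + 1) (kappa183 (d + 1) / (d + 1)) :=
    sum_exp_torusSupNorm_sub_rep_le M hδ₂ (rep M y)
  calc ‖((DeltaA n M 1)⁻¹ *ᵥ J) (bpt n M y r, μ)‖
      = ‖∑ y' : Tor M,
          ((DeltaA n M 1)⁻¹ *ᵥ fun j => if B5Blocks16.blockOf n M j.1 = y' then J j else 0) (bpt n M y r, μ)‖ := by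
        rw [mulVec_eq_sum_pieces n M (DeltaA n M 1)⁻¹ J, Finset.sum_apply]
    _ ≤ ∑ y' : Tor M,
          ‖((DeltaA n M 1)⁻¹ *ᵥ fun j => if B5Blocks16.blockOf n M j.1 = y' then J j else 0) (bpt n M y r, μ)‖ :=
        norm_sum_le _ _
    _ ≤ ∑ y' : Tor M,
          B * (2 * Nn * 2 ^ Nn * Real.exp (1 / (2 * (d + 1)))
                * Real.exp (-(1 / (2 * (d + 1)) * torusSupNorm M (rep M y - rep M y')))
            + (d + 1) * (MD183 (d + 1) Nn * periodConst (kappa183 (d + 1)) d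
                * Real.exp (-(kappa183 (d + 1) / (d + 1) * torusSupNorm M (rep M y - rep M y'))))) :=
        Finset.sum_le_sum fun y' _ => hblock y'
    _ = B * (2 * Nn * 2 ^ Nn * Real.exp (1 / (2 * (d + 1)))
              * ∑ y' : Tor M, Real.exp (-(1 / (2 * (d + 1)) * torusSupNorm M (rep M y - rep M y')))
          + (d + 1) * (MD183 (d + 1) Nn * periodConst (kappa183 (d + 1)) d
              * ∑ y' : Tor M,
                  Real.exp (-(kappa183 (d + 1) / (d + 1) * torusSupNorm M (rep M y - rep M y'))))) := by
        simp only [Finset.mul_sum, Finset.sum_add_distrib, mul_add]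
    _ ≤ B * (2 * Nn * 2 ^ Nn * Real.exp (1 / (2 * (d + 1))) * latticeConst (d + 1) (1 / (2 * (d + 1)))
          + (d + 1) * (MD183 (d + 1) Nn * periodConst (kappa183 (d + 1)) d
              * latticeConst (d + 1) (kappa183 (d + 1) / (d + 1)))) := by
        gcongr

include hn in
/-- **(1.115), FIRST ENTRY — `|GJ| ≤ O(1)|J|` for `G = Δ_1⁻¹` on the torus, CONCRETELY**: for every field `J`
on `T_η` with `|J| ≤ B` and EVERY site/direction `i = (x, μ)`,
`|(Δ_1⁻¹ J)_μ(x)| ≤ B·(2N·2^N·e^{1/(2(d+1))}·K_{d+1}(1/(2(d+1))) + (d+1)·MD183(d+1,N)·periodConst(κ₁₈₃(d+1),d)·K_{d+1}(κ₁₈₃(d+1)/(d+1)))`,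
i.e. the `ℓ^∞ → ℓ^∞` operator norm of `(DeltaA n M 1)⁻¹` is bounded by a function of `d` and `N ≥ d` alone,
UNIFORMLY in `n = L^k` and in the torus `M` (every site is a block point, `exists_eq_bpt_blockOf`).
HONEST SCOPE (i)–(v) of the header: first entry only, `a = 1`, `U = 1`, constants ours.  (Location of the
printed text: `Balaban1984PropagatorsI` p. 36, (1.115); the typed inequality is ours, not a quotation.) [folklore] -/
theorem norm_DeltaA_one_inv_mulVec_le_global {Nn : ℕ} (hN : d + 1 ≤ Nn + 1)
    (J : Tor (fine n M) × Fin (d + 1) → ℂ) {B : ℝ} (hJB : ∀ j, ‖J j‖ ≤ B)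
    (i : Tor (fine n M) × Fin (d + 1)) :
    ‖((DeltaA n M 1)⁻¹ *ᵥ J) i‖
      ≤ B * (2 * Nn * 2 ^ Nn * Real.exp (1 / (2 * (d + 1))) * latticeConst (d + 1) (1 / (2 * (d + 1)))
          + (d + 1) * (MD183 (d + 1) Nn * periodConst (kappa183 (d + 1)) d
              * latticeConst (d + 1) (kappa183 (d + 1) / (d + 1)))) := by
  obtain ⟨t, μ⟩ := i
  obtain ⟨r, hr⟩ := exists_eq_bpt_blockOf n M t
  have h := norm_DeltaA_one_inv_mulVec_bpt_le_global n hn M hN J hJB (B5Blocks16.blockOf n M t) r μ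
  rwa [← hr] at h

include hn in
/-- the same bound with the sup norm of `J` packaged as a hypothesis-free maximum: for `J ≠ 0`-free bookkeeping,
`|(Δ_1⁻¹ J)_μ(x)| ≤ C(d,N) · max_j |J(j)|` (the finite maximum over the nonempty index type realised as
`Finset.sup'`). [folklore] -/
theorem norm_DeltaA_one_inv_mulVec_le_global_sup {Nn : ℕ} (hN : d + 1 ≤ Nn + 1)
    (J : Tor (fine n M) × Fin (d + 1) → ℂ) (i : Tor (fine n M) × Fin (d + 1)) :
    ‖((DeltaA n M 1)⁻¹ *ᵥ J) i‖
      ≤ (Finset.univ.sup' (Finset.univ_nonempty_iff.mpr ⟨i⟩) fun j => ‖J j‖)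
          * (2 * Nn * 2 ^ Nn * Real.exp (1 / (2 * (d + 1))) * latticeConst (d + 1) (1 / (2 * (d + 1)))
            + (d + 1) * (MD183 (d + 1) Nn * periodConst (kappa183 (d + 1)) d
                * latticeConst (d + 1) (kappa183 (d + 1) / (d + 1)))) :=
  norm_DeltaA_one_inv_mulVec_le_global n hn M hN J
    (fun j => Finset.le_sup' (fun j => ‖J j‖) (Finset.mem_univ j)) i

end Main

end

end Literature.MathematicalPhysics.QuantumFieldTheory.Balaban1983to89.B5G115SupBound
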